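import Summits.Ventures.FusionMHD.Bench.SolovevPCFNstxMercierProfile
import Summits.Ventures.FusionMHD.Bench.SolovevPCFNstxMercierR1o8Threshold
import Summits.Ventures.FusionMHD.Bench.SolovevPCFNstxMercierR1o16Threshold
import HarnessLib

/-!
# F1 / MERCIER — the flux-surface criterion (Jardin (8.134)) APPROACHES the near-axis criterion (Bateman (7.3.2)) toward the
# magnetic axis: certified thresholds at `ρ/ρ_e = 1/8, 1/16` of the NSTX-like PCF Solov'ev equilibrium
(venture LADDER-GRIDFUSION, rung F1.MERCIER-profile; cell `gridfusion`, seat `gridfusion-sos-6` (g3), 2026-08-27.)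

The cell has TWO typed Mercier criteria from two printed sources: lit-3's near-axis form `Mercier.NearAxis.MercierCriterion`
(Bateman (7.3.2), certified for the instance in `…MercierAxis`, p472230: `F_M ∈ [1.11855148457759885405, …406]`) and the flux-surface
form `Mercier.FluxForm.SurfaceData.MercierCriterion` (Jardin (8.134)) evaluated on model-5's records `lcGGJData` of the tree's
functionals (two-sided certified thresholds at `ρ/ρ_e = 1, 3/4, 1/2, 1/4`, `…MercierProfile`, p505264). THIS FILE adds the two
inner surfaces `ρ/ρ_e = 1/8` (`…MercierR1o8Threshold`: `g_M ∈ [1.097368336, 1.097368344]`) and `ρ/ρ_e = 1/16`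
(`…MercierR1o16Threshold`: `g_M ∈ [1.113238955, 1.113238985]`) and proves, as rational inequalities between certified brackets:
* `thresholds_monotone_inner` — the ordering continues inward: `g_M⁺(1/4) < g_M⁻(1/8) ≤ g_M⁺(1/8) < g_M⁻(1/16) ≤ g_M⁺(1/16) < F_M⁻(axis)`;
* `nearAxis_gap` — the gap to the near-axis threshold is `< 2.12·10⁻²` at `1/8` and `< 5.4·10⁻³` at `1/16` (ratio ≈ 4 = (ρ₁/ρ₂)²,
  the expected `O(ρ²)` approach of the flux-surface criterion to its near-axis expansion) — a kernel-level CROSS-CHECK of the two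
  printed forms of the criterion on the typed equilibrium (as numbers; the analytic limit statement is not claimed here);
* `mercier_profile7_of_ge` — for `F ≥ F_M⁺(axis)` the criterion holds on all SEVEN certified surfaces and on the axis.
HONEST FRAMING: CERTIFIED statements about the MODEL (ideal MHD, analytic fixed-boundary PCF Solov'ev equilibrium
[cite: PatakiCerfonFreidberg2013, §6.1], `F = RB_φ` a free parameter); Mercier is a NECESSARY local-interchange criterion; nothing
here says a plasma or device is stable. No `decide` in this file.
-/

noncomputable section

open Real
open Literature.MathematicalPhysics.MHD

namespace Summit.Ventures.FusionMHD.Bench.SolovevPCFNstx.MercierProfile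

open Summit.Ventures.FusionMHD.Bench.SolovevPCFNstx

/-- **The ordering continues toward the axis:** `g_M⁺(1/4) < g_M⁻(1/8)`, `g_M⁺(1/8) < g_M⁻(1/16)`, `g_M⁺(1/16) < F_M⁻(axis)`. [folklore] -/
theorem thresholds_monotone_inner :
    SolovevPCFNstx.MercierQ1.gMercQ1Hi < SolovevPCFNstx.MercierR1o8.gMercR1o8Lo ∧ SolovevPCFNstx.MercierR1o8.gMercR1o8Hi < SolovevPCFNstx.MercierR1o16.gMercR1o16Lo
    ∧ SolovevPCFNstx.MercierR1o16.gMercR1o16Hi < SolovevPCFNstx.MercierAxis.FmercLo := by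
  unfold SolovevPCFNstx.MercierQ1.gMercQ1Hi SolovevPCFNstx.MercierR1o8.gMercR1o8Lo SolovevPCFNstx.MercierR1o8.gMercR1o8Hi SolovevPCFNstx.MercierR1o16.gMercR1o16Lo
    SolovevPCFNstx.MercierR1o16.gMercR1o16Hi SolovevPCFNstx.MercierAxis.FmercLo
  refine ⟨by norm_num, by norm_num, by norm_num⟩

/-- **`O(ρ²)` approach to the near-axis threshold (certified numbers):** `0 < F_M⁺(axis) − g_M⁻(1/8) < 212/10000` and
`0 < F_M⁺(axis) − g_M⁻(1/16) < 54/10000`. [folklore] -/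
theorem nearAxis_gap :
    0 < SolovevPCFNstx.MercierAxis.FmercHi - SolovevPCFNstx.MercierR1o8.gMercR1o8Lo ∧ SolovevPCFNstx.MercierAxis.FmercHi - SolovevPCFNstx.MercierR1o8.gMercR1o8Lo < 212 / 10000
    ∧ 0 < SolovevPCFNstx.MercierAxis.FmercHi - SolovevPCFNstx.MercierR1o16.gMercR1o16Lo ∧ SolovevPCFNstx.MercierAxis.FmercHi - SolovevPCFNstx.MercierR1o16.gMercR1o16Lo < 54 / 10000 := by
  unfold SolovevPCFNstx.MercierAxis.FmercHi SolovevPCFNstx.MercierR1o8.gMercR1o8Lo SolovevPCFNstx.MercierR1o16.gMercR1o16Lo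
  refine ⟨by norm_num, by norm_num, by norm_num, by norm_num⟩

/-- **For every `F ≥ F_M⁺(axis)` the Mercier criterion holds on the axis and on ALL SEVEN certified surfaces
`ρ/ρ_e = 1/16, 1/8, 1/4, 1/2, 3/4, 1`.** [cite: Jardin2010, §8.5.4 eq. (8.134)] -/
theorem mercier_profile7_of_ge {F : ℝ} (hF : SolovevPCFNstx.MercierAxis.FmercHi ≤ F) :
    Mercier.NearAxis.MercierCriterion (SolovevPCFNstx.MercierAxis.q0 F) SolovevPCFNstx.MercierAxis.elong 0 0
    ∧ (SolovevPCFNstx.MercierR1o16.lcR1o16Data F).MercierCriterion ∧ (SolovevPCFNstx.MercierR1o8.lcR1o8Data F).MercierCriterion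
    ∧ (SolovevPCFNstx.MercierQ1.lcQ1Data F).MercierCriterion ∧ (SolovevPCFNstx.MercierMid.lcMidData F).MercierCriterion
    ∧ (SolovevPCFNstx.MercierQ3.lcQ3Data F).MercierCriterion ∧ (SolovevPCFNstx.MercierEdge.lcEdgeData F).MercierCriterion := by
  have h16 : SolovevPCFNstx.MercierR1o16.gMercR1o16Hi ≤ F := le_trans (by unfold SolovevPCFNstx.MercierR1o16.gMercR1o16Hi SolovevPCFNstx.MercierAxis.FmercHi; norm_num) hF
  have h8 : SolovevPCFNstx.MercierR1o8.gMercR1o8Hi ≤ F := le_trans (by unfold SolovevPCFNstx.MercierR1o8.gMercR1o8Hi SolovevPCFNstx.MercierAxis.FmercHi; norm_num) hF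
  obtain ⟨h0, h1, h2, h3, h4⟩ := mercier_profile_of_ge hF
  exact ⟨h0, SolovevPCFNstx.MercierR1o16.mercierCriterion_lcR1o16Data_of_ge h16, SolovevPCFNstx.MercierR1o8.mercierCriterion_lcR1o8Data_of_ge h8,
    h1, h2, h3, h4⟩

end Summit.Ventures.FusionMHD.Bench.SolovevPCFNstx.MercierProfile

end
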